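import Summits.QuantumFields.YangMills.Theorems.BalabanUVNodesK0RecordFormatNamesLemmas
import Literature.MathematicalPhysics.QuantumFieldTheory.Balaban1983to89.B9Eq335Plaquette

/-!
# PORT PT-C, part 1 — the record's exp-chart AT THE RECORD'S NAMES: traceless (`Gᶜ = SL(2, ℂ)`-valued), entire, and the ξ-scaled plaquette
# bound `‖e^{X₁}e^{X₂}e^{−X₃}e^{−X₄} − 1‖ ≤ 2C(1+C)e^{4C}·ξ²` WITHOUT a `ℚ`-algebra instance (so that it applies to `M₂(ℂ)` in the L²-operator norm)

Cell `ym-nodeO-ideate`, porter seat `ymgap-nodeO-port-PTC-1` (gen 0) on director-ym's brief R611 (item **stmt-QuantumFields-27932**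
`BalabanUVNodes.PortRowE118U2`, signature `nodeO-cover/TYPER-Sig27932-v3-RO2.txt` sha16 `8330988af3c4ec91`, CRIT-1's R-O2 repair of record);
`--kind proof --supports stmt-QuantumFields-27932` (helper file; the closing file is `BalabanUVNodesPortU2RowE118`).  [I] = [Balaban1987RG1].
CONSUMED BY NAME, nothing re-declared: DEF-1's names (`chartMat ∕ sl2Gen ∕ recordChart ∕ recordCB ∕ chartMatLM`, `K0RecordFormatNames(Lemmas)`),
pub-balaban's `B9Eq335Plaquette` (`norm_plaq_sub_one_le`, `norm_exp_sub_exp_le_of_le`, `norm_exp_le_of_le`, `norm_exp_neg_le_of_le`,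
`norm_exp_sub_one_le_mul` — its `norm_plaquette_exp_sub_one_le ∕ b7_52_of_b9_335` carry a `[NormedAlgebra ℚ 𝔄]` binder that `Matrix (Fin 2) (Fin 2) ℂ`
does not instantiate, hence §1 below re-derives the scaled bound from the instance-free `norm_plaq_sub_one_le`), `B13Inv214OrbitSUN.det_exp` (Liouville),
`Beta.BackgroundVertices.expUnit`.

WHAT THIS FILE PROVES (theorems only; no `def`, no `instance`, no `notation`, no `sorry`; standard axioms).
* §1 ★ `norm_plaquette_exp_sub_one_le_scaled` — in any complete normed `ℂ`-algebra with `‖1‖ = 1`: for `‖Xᵢ‖ ≤ Cξ` (i = 1..4), `‖X₁ − X₃‖, ‖X₂ − X₄‖ ≤ Cξ²`,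
  `0 ≤ ξ ≤ 1`: `‖e^{X₁}e^{X₂}e^{−X₃}e^{−X₄} − 1‖ ≤ 2C(1+C)e^{4C}·ξ²` (B9 (3.35) ⇒ B7 (52) bookkeeping; first order in the differences of opposite sides).
* §2 the record's letters: `0 < recordCB F = 6L + 1`; the chart matrices `W = chartMat F K w b = Σ_a w_{b,a} τ_a` are traceless, so `det exp W = 1`
  (the chart is `Gᶜ = SL(2, ℂ)`-valued, [I] (1.10)–(1.11)).
* §3 ★ `analyticAt_recordChart` — the record's chart `recordChart F Mc k K X` is ENTIRE (its coordinates are matrix entries of `exp ∘ chartMatLM`, or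
  constants): the analyticity clause of typer-1's `B12FormatPlus.Chart44D` (v5 ✓p793008) at DEF-1's names, on ANY domain.

HONEST FRAMING.  Elementary facts about the record's chart; nothing of Bałaban's estimates ((3.36)–(3.54), (1.18), Theorem 3, the analyticity of the
PIECES `𝐄^{(j)}(X, ·)`) is asserted, ported or discharged here; 27930∕27931 untouched; K0⁷ NOT closed; NODE O not inhabited; COUNT 8∕28 · K 1∕4 UNMOVED;
finite `𝕋⁴_{L^K}` at fixed ε — NOT continuum ∕ OS ∕ Clay; **the Yang–Mills mass gap (Clay) is NOT proved by any of this.**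
-/

noncomputable section

open scoped BigOperators Matrix.Norms.L2Operator

namespace Summit.QuantumFields.YangMills.Theorems.PortU2

open Literature.MathematicalPhysics.QuantumFieldTheory.Balaban1983to89
open Literature.MathematicalPhysics.QuantumFieldTheory.Balaban1983to89.Node00
open Literature.MathematicalPhysics.QuantumFieldTheory.Balaban1983to89.T4Continuum (T4Family)
open Summit.QuantumFields.YangMills.Theorems.K0RecordFormatNames
open NormedSpace (exp)

/-! ## §1  The ξ-scaled plaquette bound through exponentials, `ℚ`-instance-free -/

section PlaquetteEstimate

open B9Eq335Plaquette (norm_plaq_sub_one_le norm_exp_sub_exp_le_of_le norm_exp_le_of_le norm_exp_neg_le_of_le norm_exp_sub_one_le_mul)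

variable {𝔄 : Type*} [NormedRing 𝔄] [NormedAlgebra ℂ 𝔄] [CompleteSpace 𝔄] [NormOneClass 𝔄]

/-- **B9 (3.35) ⇒ B7 (52), `ℚ`-instance-free**: for `‖Xᵢ‖ ≤ Cξ` (`i = 1, …, 4`), `‖X₁ − X₃‖, ‖X₂ − X₄‖ ≤ Cξ²`, `0 ≤ C`, `0 ≤ ξ ≤ 1`,
`‖e^{X₁}e^{X₂}e^{−X₃}e^{−X₄} − 1‖ ≤ 2C(1 + C)e^{4C}·ξ²` — pub-balaban's `B9Eq335Plaquette.b7_52_of_b9_335` re-derived from its instance-free plaquette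
identity `norm_plaq_sub_one_le` and the tree's `exp` estimates, so that it applies to `M₂(ℂ)` in the L²-operator norm (no `NormedAlgebra ℚ` instance there).
[cite: Balaban1985BackgroundPropagators, (3.35) p.396; Balaban1985Averaging, (52) p.26] -/
theorem norm_plaquette_exp_sub_one_le_scaled (X₁ X₂ X₃ X₄ : 𝔄) {C ξ : ℝ} (hC : 0 ≤ C) (hξ0 : 0 ≤ ξ) (hξ1 : ξ ≤ 1)
    (h₁ : ‖X₁‖ ≤ C * ξ) (h₂ : ‖X₂‖ ≤ C * ξ) (h₃ : ‖X₃‖ ≤ C * ξ) (h₄ : ‖X₄‖ ≤ C * ξ)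
    (h₁₃ : ‖X₁ - X₃‖ ≤ C * ξ ^ 2) (h₂₄ : ‖X₂ - X₄‖ ≤ C * ξ ^ 2) :
    ‖exp X₁ * exp X₂ * exp (-X₃) * exp (-X₄) - 1‖ ≤ 2 * C * (1 + C) * Real.exp (4 * C) * ξ ^ 2 := by
  have hs : 0 ≤ C * ξ := mul_nonneg hC hξ0
  have key := norm_plaq_sub_one_le (exp X₁) (exp X₂) (exp X₃) (exp X₄) (exp (-X₃)) (exp (-X₄))
    (Beta.BackgroundVertices.expUnit ℂ X₃).mul_inv (Beta.BackgroundVertices.expUnit ℂ X₄).mul_inv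
  refine key.trans ?_
  have e13 : ‖exp X₁ - exp X₃‖ ≤ C * ξ ^ 2 * Real.exp (C * ξ) :=
    (norm_exp_sub_exp_le_of_le X₁ X₃ h₁ h₃).trans (by gcongr)
  have e24 : ‖exp X₂ - exp X₄‖ ≤ C * ξ ^ 2 * Real.exp (C * ξ) :=
    (norm_exp_sub_exp_le_of_le X₂ X₄ h₂ h₄).trans (by gcongr)
  have e3 : ‖exp X₃ - 1‖ ≤ C * ξ * Real.exp (C * ξ) :=
    (norm_exp_sub_one_le_mul X₃).trans (mul_le_mul h₃ (Real.exp_le_exp.2 h₃) (Real.exp_nonneg _) hs)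
  have e4 : ‖exp X₄ - 1‖ ≤ C * ξ * Real.exp (C * ξ) :=
    (norm_exp_sub_one_le_mul X₄).trans (mul_le_mul h₄ (Real.exp_le_exp.2 h₄) (Real.exp_nonneg _) hs)
  have n2 := norm_exp_le_of_le X₂ h₂
  have n3 := norm_exp_le_of_le X₃ h₃
  have n3' := norm_exp_neg_le_of_le X₃ h₃
  have n4' := norm_exp_neg_le_of_le X₄ h₄
  have hξ2 : ξ ^ 2 ≤ ξ := by nlinarith
  have hexp : Real.exp (C * ξ) ≤ Real.exp C := Real.exp_le_exp.2 (by nlinarith)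
  have hE : 0 ≤ Real.exp C := Real.exp_nonneg C
  calc (‖exp X₁ - exp X₃‖ * ‖exp X₂‖ + ‖exp X₃‖ * ‖exp X₂ - exp X₄‖ + 2 * ‖exp X₃ - 1‖ * ‖exp X₄ - 1‖) *
        (‖exp (-X₃)‖ * ‖exp (-X₄)‖)
      ≤ (C * ξ ^ 2 * Real.exp (C * ξ) * Real.exp (C * ξ) + Real.exp (C * ξ) * (C * ξ ^ 2 * Real.exp (C * ξ)) +
          2 * (C * ξ * Real.exp (C * ξ)) * (C * ξ * Real.exp (C * ξ))) * (Real.exp (C * ξ) * Real.exp (C * ξ)) := by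
        gcongr
    _ ≤ (C * ξ ^ 2 * Real.exp C * Real.exp C + Real.exp C * (C * ξ ^ 2 * Real.exp C) +
          2 * (C * ξ * Real.exp C) * (C * ξ * Real.exp C)) * (Real.exp C * Real.exp C) := by
        gcongr
    _ = 2 * C * (ξ ^ 2 + C * ξ ^ 2) * (Real.exp C * Real.exp C * Real.exp C * Real.exp C) := by ring
    _ = 2 * C * (ξ ^ 2 + C * ξ ^ 2) * Real.exp (4 * C) := by
        rw [show 4 * C = C + C + C + C by ring, Real.exp_add, Real.exp_add, Real.exp_add]
    _ = 2 * C * (1 + C) * Real.exp (4 * C) * ξ ^ 2 := by ring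

end PlaquetteEstimate

/-! ## §2  The record's letters: the (1.12) constant, traceless chart matrices, `det exp W = 1` -/

section RecordFacts

variable (F : T4Family)

/-- The record's (1.12) constant `O(1)LMB = 6L + 1` is positive. [cite: Balaban1987RG1, (1.12) p.262 (bookkeeping)] -/
theorem recordCB_pos : 0 < recordCB F := by
  rw [recordCB, sect2NumericsOfThm1C_cB]
  positivity

/-- The 𝔰𝔩₂ generators `(E₁₂, E₂₁, E₁₁ − E₂₂)` are traceless. [cite: Balaban1987RG1, (1.10) p.262 (bookkeeping)] -/
theorem trace_sl2Gen (a : Fin 3) : (sl2Gen a).trace = 0 := by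
  fin_cases a <;> simp [sl2Gen, Matrix.trace_fin_two]

/-- The chart matrices `W = Σ_a w_{b,a} τ_a` are traceless (`𝔤ᶜ = 𝔰𝔩₂(ℂ)`-valued). [cite: Balaban1987RG1, (1.10) p.262 (bookkeeping)] -/
theorem trace_chartMat (K : ℕ) (w : Fin (recordChartDim F K) → ℂ) (b : PBond (F.P K) 0) : (chartMat F K w b).trace = 0 := by
  simp [chartMat, Matrix.trace_sum, Matrix.trace_smul, trace_sl2Gen]

/-- **`det exp W = 1`**: the chart is `Gᶜ = SL(2, ℂ)`-valued (Liouville's formula `det eˣ = e^{tr X}`, the tree's `B13Inv214OrbitSUN.det_exp`).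
[cite: Balaban1987RG1, (1.10)–(1.11) p.262] -/
theorem det_exp_chartMat (K : ℕ) (w : Fin (recordChartDim F K) → ℂ) (b : PBond (F.P K) 0) :
    Matrix.det (exp (chartMat F K w b)) = 1 := by
  rw [B13Inv214OrbitSUN.det_exp, trace_chartMat, Complex.exp_zero]

end RecordFacts

/-! ## §3  The record's chart is entire -/

section Analytic

variable (F : T4Family)

/-- **The record's chart is ENTIRE**: every coordinate of `recordChart F Mc k K X w` is a matrix entry of `exp (chartMatLM F K b w)` (a continuous
linear map followed by the exponential of the Banach algebra `M₂(ℂ)` and an entry functional) or a constant (`1` off `X`, `𝐉 = 0`).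
[cite: Balaban1987RG1, p.258 («U_k = exp(iηH′)»), (4.4) p.281] -/
theorem analyticAt_recordChart (Mc k K : ℕ) (X : (recordDomSys F Mc k K).Dom) (w₀ : Fin (recordChartDim F K) → ℂ) :
    AnalyticAt ℂ (recordChart F Mc k K X) w₀ := by
  classical
  have hcoord : recordChart F Mc k K X = fun w n => recordChart F Mc k K X w n := rfl
  rw [hcoord]
  refine AnalyticAt.pi fun n => ?_
  have hexp : ∀ (b : PBond (F.P K) 0) (i j : Fin 2),
      AnalyticAt ℂ (fun w : Fin (recordChartDim F K) → ℂ => (exp (chartMat F K w b)) i j) w₀ := by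
    intro b i j
    have h1 : AnalyticAt ℂ (fun w : Fin (recordChartDim F K) → ℂ => chartMat F K w b) w₀ := by
      have : (fun w : Fin (recordChartDim F K) → ℂ => chartMat F K w b) = LinearMap.toContinuousLinearMap (chartMatLM F K b) := by
        ext w; simp
      rw [this]
      exact (LinearMap.toContinuousLinearMap (chartMatLM F K b)).analyticAt w₀
    have h2 : AnalyticAt ℂ (fun w : Fin (recordChartDim F K) → ℂ => exp (chartMat F K w b)) w₀ :=
      (NormedSpace.exp_analytic (𝕂 := ℂ) _).comp h1
    have h3 : AnalyticAt ℂ (fun A : MatA 2 => A i j) (exp (chartMat F K w₀ b)) := by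
      have : (fun A : MatA 2 => A i j) = LinearMap.toContinuousLinearMap (Matrix.entryLinearMap ℂ ℂ i j) := by
        ext A; simp
      rw [this]
      exact (LinearMap.toContinuousLinearMap (Matrix.entryLinearMap ℂ ℂ i j)).analyticAt _
    exact AnalyticAt.comp (f := fun w : Fin (recordChartDim F K) → ℂ => exp (chartMat F K w b)) (x := w₀) h3 h2
  unfold recordChart encodeCfg
  rcases hn : (cfgEquiv F K).symm n with ⟨s, i, j⟩
  rcases s with b | b
  · simp only [Sum.elim_inl]
    by_cases hb : b ∈ domBonds F Mc k K X
    · simp only [if_pos hb]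
      exact hexp b i j
    · simp only [if_neg hb]
      exact analyticAt_const
  · simp only [Sum.elim_inr]
    exact analyticAt_const

/-- The record's chart is analytic on every set (in particular on print's (4.4) domain `recordDom44`). [cite: Balaban1987RG1, (4.4) p.281] -/
theorem analyticOnNhd_recordChart (Mc k K : ℕ) (X : (recordDomSys F Mc k K).Dom) (D : Set (Fin (recordChartDim F K) → ℂ)) :
    AnalyticOnNhd ℂ (recordChart F Mc k K X) D :=
  fun w _ => analyticAt_recordChart F Mc k K X w

end Analytic

end Summit.QuantumFields.YangMills.Theorems.PortU2

end
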